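import Summits.AtomisticToContinuum.HydrodynamicLimit.Theses.MourreKoopmanCharges
import HarnessLib

/-!
# `ChargesCompleteHS` (stmt-AtomisticToContinuum-14141): the glue from its two typed supports

Route `MourreKoopmanCharges` files the infinite-volume completeness of the five charges,
`ChargesCompleteHS` (for every low-activity hard-sphere Gibbs datum `F` with Alexander flow,
`F.ChargesComplete`, i.e. `F.conservedSpace ≤ F.chargeSpace`), with the two-layer plan
"`ChargesCompleteHS ⇐ ConservedVectorsOneBody ∧ OneBodySectorRigidity`, glue `chargesCompleteHS_of`
proved in the planner's Sketch.lean with the tree lemma `conservedSpace_le_generatorDomain` — a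
prover may land it as `--supports`". This file lands that glue:

* datum by datum: `𝒬₀ ≤ 𝒟` and `𝒟 ⊓ D(L) ≤ 𝒞` give `𝒬₀ ≤ 𝒞`, because conserved vectors lie in
  the domain of the generator (`t ↦ U_t ψ` is constant; tree lemma
  `FluctuationDynamics.conservedSpace_le_generatorDomain`) — `chargesComplete_of_le`;
* with the items' common quantifier prefix (`∀ σ β > 0 ∃ z₀ ∀ z < z₀ ∀ F, Gibbs → Alexander → …`,
  the two thresholds combined by `min`): `chargesCompleteHS_of :
  ConservedVectorsOneBody → OneBodySectorRigidity → ChargesCompleteHS`;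
* conversely `ChargesCompleteHS → ConservedVectorsOneBody` (`𝒞 ⊆ 𝒟`): the virial support is a
  NECESSARY condition for the crux, and given the rigidity support the two are equivalent.

References: H. Spohn, *Large Scale Dynamics of Interacting Particles* (1991), Part I §7.1;
B. Doyon, Comm. Math. Phys. 391 (2022), §1 and §4.4.
-/

noncomputable section

namespace Summit.AtomisticToContinuum.HydrodynamicLimit.Theorems

open Literature.MathematicalPhysics.KineticTheory
open Summit.AtomisticToContinuum.HydrodynamicLimit.Theses.MourreKoopmanCharges
  (ConservedVectorsOneBody OneBodySectorRigidity ChargesCompleteHS)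

namespace MourreKoopmanChargesChargesCompleteHSGlue

/-- **Glue, for one datum**: if every conserved vector lies in the one-body sector and every
one-body vector in the domain of the generator is a charge, the charges are complete
(conserved vectors lie in the domain of the generator). [folklore] -/
theorem chargesComplete_of_le {σ : ℝ} (F : HardSphereFluctuationData σ)
    (h₁ : F.conservedSpace ≤ F.oneBodySector)
    (h₂ : F.oneBodySector ⊓ F.generatorDomain ≤ F.chargeSpace) : F.ChargesComplete :=
  fun _ψ hψ => h₂ ⟨h₁ hψ, F.conservedSpace_le_generatorDomain hψ⟩

/-- **`chargesCompleteHS_of`** (the route's foreseen glue): `ConservedVectorsOneBody` and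
`OneBodySectorRigidity` imply `ChargesCompleteHS` (take the smaller of the two activity
thresholds). [folklore] -/
theorem chargesCompleteHS_of (h₁ : ConservedVectorsOneBody) (h₂ : OneBodySectorRigidity) :
    ChargesCompleteHS := by
  intro σ hσ β hβ
  obtain ⟨z₁, hz₁, H₁⟩ := h₁ σ hσ β hβ
  obtain ⟨z₂, hz₂, H₂⟩ := h₂ σ hσ β hβ
  refine ⟨min z₁ z₂, lt_min hz₁ hz₂, fun z hz hzlt F hG hΦ => ?_⟩
  exact chargesComplete_of_le F
    (H₁ z hz (lt_of_lt_of_le hzlt (min_le_left _ _)) F hG hΦ)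
    (H₂ z hz (lt_of_lt_of_le hzlt (min_le_right _ _)) F hG hΦ)

/-- Conversely the crux implies the virial support: `ChargesCompleteHS → ConservedVectorsOneBody`
(`𝒬₀ ≤ 𝒞 ⊆ 𝒟`, tree lemma `chargeSpace_le_oneBodySector`). [folklore] -/
theorem conservedVectorsOneBody_of_chargesCompleteHS (h : ChargesCompleteHS) :
    ConservedVectorsOneBody := by
  intro σ hσ β hβ
  obtain ⟨z₀, hz₀, H⟩ := h σ hσ β hβ
  exact ⟨z₀, hz₀, fun z hz hzlt F hG hΦ =>
    (H z hz hzlt F hG hΦ).trans F.chargeSpace_le_oneBodySector⟩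

end MourreKoopmanChargesChargesCompleteHSGlue

end Summit.AtomisticToContinuum.HydrodynamicLimit.Theorems
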